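import Summits.AtomisticToContinuum.Crystallization.Theorems.FreeSplittingCertificatesStrictSplittingRuleP1LedgerGauge
import Summits.AtomisticToContinuum.Crystallization.Theorems.FreeSplittingCertificatesStrictSplittingRuleP1FluxBlockEnclosure
import Summits.AtomisticToContinuum.Crystallization.Theorems.FreeSplittingCertificatesStrictSplittingRuleNearBoxGridHcp

/-!
# `StrictSplittingRule` (stmt-AtomisticToContinuum-12560): the endpoint with the near certificate's TWO TIERS as hypotheses — grid `LDLᵀ` ledgers + box curvature bounds — interpolation, margin arithmetic, gauge reduction, deflation removal and flux booking done IN the kernel (P1 interpolant object, part 108)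

Route `FreeSplittingCertificates`, crux r3 `StrictSplittingRule` (H12⋆ = `stub_coreJointCoercive`), unit b2b-freesplit-B gen 52.
(This file carries PRIVATE copies of part 107's two theorems — `cross_eq_zero_of_cross_pair'`, `nearForm_nonneg_of_ledger_coercive'` — so that it imports only
accepted modules; the public versions are part 107, `…P1LedgerDeflate`.)
VALUE = a conditional endpoint whose near hypothesis has EXACTLY the shape of what is certified (HOME CERT §34 (h), §42, §43, §47, §48; THEOREM-B).

`coreJointCoercive_cell_of_certificates₁₅` (part 104) takes (NC∃′): for THIS `(a,h)`, some near tables make the finite near form with the EXACT collar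
flux nonnegative on the least-squares constraint set.  What the cell certifies OUTSIDE the kernel is different in shape: for the pinned tables,
(grid) 81 + 81 exact integer-`LDLᵀ` ledgers `X(a_i,h_j) ⪰ m_ij·G ⪰ (583/2²⁷)·G` of the DEFLATED, GAUGED ledger family `X(a,h;u)` on unconstrained
displacements of the active site set (nearcert/ballcert v10; verify44; fam51 → verify44), (box) range-AD curvature bounds `|∂²X/∂a²| ≤ B_aa·G`,
`|∂²X/∂h²| ≤ B_hh·G` on the whole `HcpFamilyMin` box (boxnear/d2, r2a/Acc46, fam51: all below 10941 / 3440), and (ENC) block-row bounds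
`Σ_{q′}‖(F_exact − F₀)_{qq′}‖_F ≤ Δ_q` for the booked collar flux (fluxform; fluxdiv50) — and then, ON PAPER / in python: bilinear-interpolation error
`ρ = (B_aa + B_hh)p²/8`, `m_min − ρ > 0`; the reduction `Q₀(u) = Q̃(V(u))` from unconstrained `u` to the constraint set; removal of the rigid deflation;
`F_exact ⪯ F₀ + diag Δ`.
**`coreJointCoercive_cell_of_certificates₁₆`** takes the three certified tiers THEMSELVES as hypotheses — (NC_grid), (NC_box) (with the calculus side
condition that the `a`- and `h`-derivatives of the explicit family exist), (ENC) — for SOME near tables `M₁, N` (support `QT`) and flux tables `F₀, Δ`,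
both as FAMILIES in `(a,h)` (nearcert's near tables carry the `(a,h)`-dependent ω-receipt diagonal and matched far payments, CERT §41 (a); the side
conditions of `…₁₅` are asked at the theorem's `(a,h)` only), and active site sets `S ∋ p` containing two sites not collinear with `p`, the family being the kernel object `p1LedgerX` (part 106), and does the rest in the
kernel: `near_gridBox_lower_v10` (part `…NearBoxGridHcp`: `X(a,h;u) ≥ (168829799/52428800000000)·Σ_{q∈S}‖u_q‖²` on the box), `nearForm_nonneg_of_ledger_coercive`
(part 107: the booked near form is `≥ 0` on the constraint set), `p1ExactFluxSum_le_p1NearFlux_of_blockRows` (part 105: exact flux `≤` booked flux), hence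
(NC∃′), hence `…₁₅`.  (B∃_fin, 12a), (S_fin), (TAB′), (PAY_near) are verbatim.
What remains OUTSIDE the kernel for the near side: the 162 node inequalities (finite: one rational LMI each), the two curvature bounds (interval range
AD over the box), the block-row flux bounds (interval, box-uniform), and the existence of the derivatives of the explicit finite family (elementary
calculus, not a certificate); plus the identification of `p1LedgerX` with nearcert's ledger (audited term by term, CERT §41, §48 (b)).
NOT a proof of H12⋆, NOT summit progress.  [folklore]
-/

noncomputable section

open Set Function Metric MeasureTheory Filter Topology
open scoped BigOperators NNReal ENNReal Classical Matrix

namespace Summit.AtomisticToContinuum.Crystallization.Theorems.StrictSplittingRuleBirth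

open Literature.MathematicalPhysics.StatisticalMechanics
open Summit.AtomisticToContinuum.Crystallization.Theorems.PalmUnimodularRigidity.LayeredLawsSelectHcp

/-! ### Local copies of part 107 (`…P1LedgerDeflate`, filed as p373353): kept PRIVATE so that this file depends only on accepted modules. -/

/-- (local copy of part 107) **Two independent directions pin a rotation vector**: `ω × d₁ = 0`, `ω × d₂ = 0` and `d₁ × d₂ ≠ 0` force `ω = 0`
(nine trilinear identities `ω_i (d₁ × d₂)_k ∈ span{(ω × d₁)_j, (ω × d₂)_j}`). [folklore] -/
private theorem cross_eq_zero_of_cross_pair' {ω d₁ d₂ : Fin 3 → ℝ} (h1 : ω ⨯₃ d₁ = 0) (h2 : ω ⨯₃ d₂ = 0) (hn : d₁ ⨯₃ d₂ ≠ 0) :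
    ω = 0 := by
  have h10 : ω 1 * d₁ 2 - ω 2 * d₁ 1 = 0 := by have := congrFun h1 0; simpa [cross_apply] using this
  have h11 : ω 2 * d₁ 0 - ω 0 * d₁ 2 = 0 := by have := congrFun h1 1; simpa [cross_apply] using this
  have h12 : ω 0 * d₁ 1 - ω 1 * d₁ 0 = 0 := by have := congrFun h1 2; simpa [cross_apply] using this
  have h20 : ω 1 * d₂ 2 - ω 2 * d₂ 1 = 0 := by have := congrFun h2 0; simpa [cross_apply] using this
  have h21 : ω 2 * d₂ 0 - ω 0 * d₂ 2 = 0 := by have := congrFun h2 1; simpa [cross_apply] using this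
  have h22 : ω 0 * d₂ 1 - ω 1 * d₂ 0 = 0 := by have := congrFun h2 2; simpa [cross_apply] using this
  have key : ∀ i k : Fin 3, ω i * (d₁ ⨯₃ d₂) k = 0 := by
    intro i k
    fin_cases i <;> fin_cases k <;>
      simp only [cross_apply, Fin.isValue, Fin.zero_eta, Fin.mk_one, Fin.reduceFinMk, Matrix.cons_val_zero, Matrix.cons_val_one,
        Matrix.cons_val]
    · linear_combination d₂ 1 * h11 + d₂ 2 * h12 + d₁ 0 * h20
    · linear_combination (-d₂ 0) * h11 + d₁ 0 * h21
    · linear_combination (-d₂ 0) * h12 + d₁ 0 * h22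
    · linear_combination (-d₂ 1) * h10 + d₁ 1 * h20
    · linear_combination d₂ 0 * h10 + d₂ 2 * h12 + d₁ 1 * h21
    · linear_combination (-d₂ 1) * h12 + d₁ 1 * h22
    · linear_combination (-d₂ 2) * h10 + d₁ 2 * h20
    · linear_combination (-d₂ 2) * h11 + d₁ 2 * h21
    · linear_combination (-d₂ 2) * h12 - d₁ 0 * h20 - d₁ 1 * h21
  obtain ⟨k, hk⟩ := Function.ne_iff.1 hn
  funext i
  exact (mul_eq_zero.1 (key i k)).resolve_right hk

/-- (local copy of part 107) **DEFLATION REMOVAL / THE NEAR REDUCTION IN THE KERNEL.**  `Q` is an arbitrary functional of the lattice values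
(instantiated with the booked finite near form); the hypothesis `hX` is the conclusion of the grid + box tiers (`X ⪰ (m_min − ρ)·G` on the box);
`S` = the active site set of the certificate (any finite set containing `p` and two sites not collinear with `p`).  NOT a proof of H12⋆, NOT summit
progress. [folklore] -/
private theorem nearForm_nonneg_of_ledger_coercive' {a h : ℝ} (ha : 0 < a) (p : ℤ × ℤ × ℤ) (S : Finset (ℤ × ℤ × ℤ)) (hpS : p ∈ S)
    {q₁ q₂ : ℤ × ℤ × ℤ} (hq₁ : q₁ ∈ S) (hq₂ : q₂ ∈ S) (hx : p1Rel a h p q₁ ⨯₃ p1Rel a h p q₂ ≠ 0)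
    (Q : (ℤ × ℤ × ℤ → (Fin 3 → ℝ)) → ℝ) {c : ℝ} (hc : 0 < c)
    (hX : ∀ u : ℤ × ℤ × ℤ → (Fin 3 → ℝ), c * p1NormSq S u ≤ Q (p1Vals a h p (p1StarAt p) u) + p1Defl a h p S u)
    {V : ℤ × ℤ × ℤ → (Fin 3 → ℝ)} (hVp : V p = 0)
    (hmom : ∀ Z : Fin 3 → Fin 3 → ℝ, (∀ j k, Z j k = -Z k j) →
      ∑ q ∈ p1StarAt p, ∑ k : Fin 3, V q k * (∑ j : Fin 3, (hcpSite a h q j - hcpSite a h p j) * Z j k) = 0) :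
    0 ≤ Q V := by
  -- the six deflation functionals of the rigid fields, as a linear endomorphism of ℝ⁶
  let L : (Fin 6 → ℝ) →ₗ[ℝ] (Fin 6 → ℝ) :=
    { toFun := fun cc => p1RigMom a h p S (p1Rigid a h p cc)
      map_add' := fun x y => by
        have e1 : p1Rigid a h p (x + y) - p1Rigid a h p y = p1Rigid a h p x := by
          rw [← p1Rigid_sub, add_sub_cancel_right]
        have e2 := p1RigMom_sub a h p S (p1Rigid a h p (x + y)) (p1Rigid a h p y)
        rw [e1] at e2
        rw [e2, sub_add_cancel]
      map_smul' := fun t x => by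
        simp only [p1Rigid_smul, p1RigMom_smul, RingHom.id_apply] }
  -- (1) L is injective: a rigid field with vanishing functionals is gauged to zero and undeflated, so coercivity kills it on S
  have hinj : Function.Injective L := by
    refine (injective_iff_map_eq_zero L).2 fun cc hcc => ?_
    have hcc' : p1RigMom a h p S (p1Rigid a h p cc) = 0 := hcc
    set r := p1Rigid a h p cc with hr
    have hnorm : p1NormSq S r = 0 := by
      by_contra hne
      have hpos : 0 < p1NormSq S r := lt_of_le_of_ne (p1NormSq_nonneg S r) (Ne.symm hne)
      have hcn : 0 < c * p1NormSq S r := mul_pos hc hpos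
      set K : ℝ := (|Q 0| + 1) / (c * p1NormSq S r) + 1 with hK
      have hK0 : 0 ≤ (|Q 0| + 1) / (c * p1NormSq S r) := by positivity
      have hK1 : 1 ≤ K := by rw [hK]; linarith
      have hXt := hX (K • r)
      have hV0 : p1Vals a h p (p1StarAt p) (K • r) = 0 := by
        rw [p1Vals_smul, hr, p1Vals_p1Rigid ha, smul_zero]
      have hD0 : p1Defl a h p S (K • r) = 0 :=
        p1Defl_eq_zero_of_rigMom a h p S (by rw [p1RigMom_smul, hcc', smul_zero])
      rw [hV0, hD0, add_zero, p1NormSq_smul] at hXt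
      -- hXt : c * (K ^ 2 * ‖r‖²_S) ≤ Q 0, but c‖r‖²·K² ≥ c‖r‖²·K = |Q 0| + 1 + c‖r‖² > Q 0
      have h1 : c * p1NormSq S r * K ≤ c * (K ^ 2 * p1NormSq S r) := by
        have : c * p1NormSq S r * K * 1 ≤ c * p1NormSq S r * K * K :=
          mul_le_mul_of_nonneg_left hK1 (by positivity)
        nlinarith
      have h2 : c * p1NormSq S r * K = (|Q 0| + 1) + c * p1NormSq S r := by
        rw [hK]; field_simp
      have h3 : Q 0 ≤ |Q 0| := le_abs_self _
      linarith
    have hrS : ∀ q ∈ S, r q = 0 := fun q hq => eq_zero_of_p1NormSq_eq_zero hnorm hq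
    have ht : (![cc 0, cc 1, cc 2] : Fin 3 → ℝ) = 0 := by
      have := hrS p hpS
      simpa [hr, p1Rigid, p1Rel_self] using this
    have hω1 : ![cc 3, cc 4, cc 5] ⨯₃ p1Rel a h p q₁ = 0 := by
      have := hrS q₁ hq₁
      simpa [hr, p1Rigid, ht] using this
    have hω2 : ![cc 3, cc 4, cc 5] ⨯₃ p1Rel a h p q₂ = 0 := by
      have := hrS q₂ hq₂
      simpa [hr, p1Rigid, ht] using this
    have hω := cross_eq_zero_of_cross_pair' hω1 hω2 hx
    funext k
    fin_cases k
    · have := congrFun ht 0; simpa using this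
    · have := congrFun ht 1; simpa using this
    · have := congrFun ht 2; simpa using this
    · have := congrFun hω 0; simpa using this
    · have := congrFun hω 1; simpa using this
    · have := congrFun hω 2; simpa using this
  -- (2) hence surjective: a rigid field with the same six functionals as V
  have hsurj : Function.Surjective L := LinearMap.injective_iff_surjective.1 hinj
  obtain ⟨cc, hcc⟩ := hsurj (p1RigMom a h p S V)
  have hcc' : p1RigMom a h p S (p1Rigid a h p cc) = p1RigMom a h p S V := hcc
  set w := V - p1Rigid a h p cc with hw
  have hw0 : p1RigMom a h p S w = 0 := by
    rw [hw, p1RigMom_sub, hcc', sub_self]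
  have hDw : p1Defl a h p S w = 0 := p1Defl_eq_zero_of_rigMom a h p S hw0
  have hVw : p1Vals a h p (p1StarAt p) w = V := by
    rw [hw, p1Vals_sub, p1Vals_p1Rigid ha, sub_zero, p1Vals_eq_self hVp hmom]
  have key := hX w
  rw [hVw, hDw, add_zero] at key
  exact le_trans (mul_nonneg hc.le (p1NormSq_nonneg S w)) key

/-- The booked near form (flux enclosure `(F₀, Δ)` on `QF` inside `p1NearForm`) is the flux-free near form minus `κ·p1NearFlux F₀ Δ QF`. -/
theorem p1NearForm_booked_eq (a h κ₁ κ₃ κ : ℝ) (p : ℤ × ℤ × ℤ) (Y₁ : Finset (ℤ × ℤ × ℤ)) (β : Bool → (ℤ × ℤ × ℤ) → (ℤ × ℤ × ℤ) → ℝ)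
    (M₁ N : Bool → (ℤ × ℤ × ℤ) → (ℤ × ℤ × ℤ) → (ℤ × ℤ × ℤ) → ℝ)
    (w : (ℤ × ℤ × ℤ) × (ℤ × ℤ × ℤ) → ℝ) (sv : ℤ × ℤ × ℤ) (wv : (ℤ × ℤ × ℤ) → ℝ) (colβ : (ℤ × ℤ × ℤ) → ℝ)
    (SH QB QT QF : Finset (ℤ × ℤ × ℤ)) (LEG : Finset ((ℤ × ℤ × ℤ) × (ℤ × ℤ × ℤ)))
    (L U PAYM Δ : (ℤ × ℤ × ℤ) → ℝ) (FL0 : (ℤ × ℤ × ℤ) × Fin 3 → (ℤ × ℤ × ℤ) × Fin 3 → ℝ)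
    (V : ℤ × ℤ × ℤ → (Fin 3 → ℝ)) :
    p1NearForm a h κ₁ κ₃ κ p Y₁ β M₁ N w sv wv colβ SH QB QT QF LEG L U PAYM Δ FL0 V =
      p1NearForm a h κ₁ κ₃ κ p Y₁ β M₁ N w sv wv colβ SH QB QT ∅ LEG L U PAYM (fun _ => 0) (fun _ _ => 0) V -
        κ * p1NearFlux FL0 Δ QF V := by
  unfold p1NearForm
  rw [p1NearFlux_empty]
  ring

/-- **THE CELL'S ENDPOINT WITH THE NEAR CERTIFICATE'S TIERS AS HYPOTHESES.**  See the module docstring.  For `(a,h)` in the `HcpFamilyMin` box,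
H12⋆ `CoreJointCoercive a h (1/3) (1/12)` follows from (B∃_fin, 12a), (S_fin), (TAB′), (PAY_near) (verbatim from part 104) and
(NC_tiers): `(a,h)`-families of near tables `M₁, N` (stencilled, decaying, supported on `QT` at the theorem's `(a,h)`) and of flux tables `F₀, Δ`, and
active site sets `S`, such that at each representative
`p`: (ACT) `p ∈ S p` and `S p` holds two sites not collinear with `p`; (ENC) block-row bounds of the exact collar flux against `(F₀, Δ)` at `(a,h)`;
(NC_grid) `(583/2²⁷)·Σ_{q∈S}‖u_q‖² ≤ p1LedgerX (a_i,h_j) … u` at the 81 nodes, all `u`; (NC_box) for every `u`, `a ↦ X` and `h ↦ X` twice differentiable on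
the box `[0.97119, 0.97139] × [0.79284, 0.79304]` with `∂²X/∂a² ≤ 10941·Σ‖u_q‖²`, `∂²X/∂h² ≤ 3440·Σ‖u_q‖²`.
NOT a proof of H12⋆ (the tiers are certified outside the kernel), NOT summit progress. [folklore] -/
theorem coreJointCoercive_cell_of_certificates₁₆ {a h : ℝ} (ha : 0 < a) (hh : 0 < h) (hfam : HcpFamilyMin a h)
    -- (B∃_fin, 12a) THE PER-CELL BUDGET at each representative FOR SOME allocation tables that follow the EXACT RULE on the cells ≥ 12a away, asked only for the FINITELY MANY cells of the 12a cell box with a vertex within 12a THAT CARRY LOAD under the tables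
    (hB : ∀ p ∈ ({(0, 0, 0), (1, 0, 0)} : Finset (ℤ × ℤ × ℤ)),
      ∃ θ θv : (ℤ × ℤ × ℤ) × (ℤ × ℤ × ℤ) → (ℤ × ℤ × ℤ) × Fin 6 → ℝ,
        (∀ e T, 0 ≤ θ e T) ∧ (∀ e, (Function.support (θ e)).Finite) ∧ (∀ T, (Function.support fun e => θ e T).Finite) ∧
        (∀ e, p1FarW a h (p1Phi0 p) p e ≠ 0 → ∑ᶠ T, θ e T = 1) ∧
        (∀ e T, θ e T ≠ 0 → ∃ m m' : Fin 4, e.1 = T.1 + p1VertOff (p1Par T.1) T.2 m ∧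
          e.1 + e.2 = T.1 + p1VertOff (p1Par T.1) T.2 m') ∧
        (∀ e T, 0 ≤ θv e T) ∧ (∀ e, (Function.support (θv e)).Finite) ∧ (∀ T, (Function.support fun e => θv e T).Finite) ∧
        (∀ e, (∑ i : Fin 3, (2 / 3) * ((if e.2 = p1RouteOff e.1 i then p1FarWv a h (p1Phi0 p) p e.1 else 0) +
          (if p1RouteOff (e.1 - (p1SV - e.2)) i = p1SV - e.2 then p1FarWv a h (p1Phi0 p) p (e.1 - (p1SV - e.2)) else 0))) ≠ 0 → ∑ᶠ T, θv e T = 1) ∧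
        (∀ e T, θv e T ≠ 0 → ∃ m m' : Fin 4, e.1 = T.1 + p1VertOff (p1Par T.1) T.2 m ∧
          e.1 + e.2 = T.1 + p1VertOff (p1Par T.1) T.2 m') ∧
        (∀ T : (ℤ × ℤ × ℤ) × Fin 6, (∀ m : Fin 4, 12 * a ≤ ‖hcpSite a h (T.1 + p1VertOff (p1Par T.1) T.2 m) - hcpSite a h p‖) →
          ∀ e, θ e T = p1ThetaX a h p e T ∧ θv e T = p1ThetaX a h p e T) ∧
        ∀ (T : (ℤ × ℤ × ℤ) × Fin 6), T.1 ∈ p1CellBox12 p →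
          (∃ m : Fin 4, ‖hcpSite a h (T.1 + p1VertOff (p1Par T.1) T.2 m) - hcpSite a h p‖ < 12 * a) → (∃ e, θ e T ≠ 0 ∨ θv e T ≠ 0) →
          ∀ (G : Fin 3 → Fin 3 → ℝ),
      (∑ᶠ e : (ℤ × ℤ × ℤ) × (ℤ × ℤ × ℤ), θ e T * p1FarW a h (p1Phi0 p) p e *
          fpSq (fun k => (hcpSite a h (e.1 + e.2) 0 - hcpSite a h e.1 0) * G 0 k +
            (hcpSite a h (e.1 + e.2) 1 - hcpSite a h e.1 1) * G 1 k + (hcpSite a h (e.1 + e.2) 2 - hcpSite a h e.1 2) * G 2 k)) +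
      (∑ᶠ e : (ℤ × ℤ × ℤ) × (ℤ × ℤ × ℤ), θv e T *
          (∑ i : Fin 3, (2 / 3) * ((if e.2 = p1RouteOff e.1 i then p1FarWv a h (p1Phi0 p) p e.1 else 0) +
            (if p1RouteOff (e.1 - (p1SV - e.2)) i = p1SV - e.2 then p1FarWv a h (p1Phi0 p) p (e.1 - (p1SV - e.2)) else 0))) *
          fpSq (fun k => (hcpSite a h (e.1 + e.2) 0 - hcpSite a h e.1 0) * G 0 k +
            (hcpSite a h (e.1 + e.2) 1 - hcpSite a h e.1 1) * G 1 k + (hcpSite a h (e.1 + e.2) 2 - hcpSite a h e.1 2) * G 2 k)) +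
      p1CellDefectG a h (fun y k l => (193 / 125) * ((7 * (5 / 4 : ℝ) + 3 / 4) / 4) * fpChi ((81 / 20 * a) ^ 2) ((27 / 5 * a) ^ 2) (y - fun k => hcpSite a h p k) ^ 2 *
          (fpSq (y - fun k => hcpSite a h p k))⁻¹ ^ 5 * ((y - fun k => hcpSite a h p k) k * (y - fun k => hcpSite a h p k) l)) T G ≤
      (193 / 125) * ((5 / 2 * (1 / 24 * fpSymSq G) + 5 / 2 * (1 / 24 * (fpFrob G - fpSymSq G))) *
        ∫ y in p1RealCell a h T, fpChi ((81 / 20 * a) ^ 2) ((27 / 5 * a) ^ 2) (y - fun k => hcpSite a h p k) ^ 2 * (fpSq (y - fun k => hcpSite a h p k))⁻¹ ^ 3))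
    -- (S_fin) per-site domination off the PINNED reach set at the FINITELY MANY sites of the 20a index box with `‖y_q − y_p‖ < 20a`; (TAB') the PINNED certified tables, `L` NORMALISED by `‖y_q − y_p‖²` (the certificates' convention)
    (hS : ∀ p ∈ ({(0, 0, 0), (1, 0, 0)} : Finset (ℤ × ℤ × ℤ)),
      ∀ q ∈ Finset.Icc (p.1 - 26) (p.1 + 26) ×ˢ (Finset.Icc (p.2.1 - 34) (p.2.1 + 34) ×ˢ Finset.Icc (p.2.2 - 23) (p.2.2 + 23)),
      q ∉ p1QB p → q ≠ p → ‖hcpSite a h q - hcpSite a h p‖ < 20 * a → ∀ z : Fin 3 → ℝ,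
      0 ≤ 1 / 2 * (ljSqDeriv (‖hcpSite a h q - hcpSite a h p‖ ^ 2) * fpSq z +
          2 * (1 / 2 * (7 * ((‖hcpSite a h q - hcpSite a h p‖ ^ 2)⁻¹) ^ 8 -
            4 * ((‖hcpSite a h q - hcpSite a h p‖ ^ 2)⁻¹) ^ 5)) * p1NRad a h p (fun _ => z) q ^ 2) +
        p1SiteBare a h (fun y k l => (193 / 125) * ((7 * (5 / 4 : ℝ) + 3 / 4) / 4) * fpChi ((81 / 20 * a) ^ 2) ((27 / 5 * a) ^ 2) (y - fun k => hcpSite a h p k) ^ 2 *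
          (fpSq (y - fun k => hcpSite a h p k))⁻¹ ^ 5 * ((y - fun k => hcpSite a h p k) k * (y - fun k => hcpSite a h p k) l)) (fun _ => z) q -
        p1SiteBare a h (fun y k l => (193 / 125) * ((3 / 4 : ℝ) / 4) * fpChi ((81 / 20 * a) ^ 2) ((27 / 5 * a) ^ 2) (y - fun k => hcpSite a h p k) ^ 2 *
          (fpSq (y - fun k => hcpSite a h p k))⁻¹ ^ 4 * (if k = l then 1 else 0)) (fun _ => z) q)
    (hTab : ∀ p ∈ ({(0, 0, 0), (1, 0, 0)} : Finset (ℤ × ℤ × ℤ)), ∀ q ∈ p1QB p, q ≠ p → ∀ z : Fin 3 → ℝ,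
      (p1LU p q).1 / ‖hcpSite a h q - hcpSite a h p‖ ^ 2 * p1NRad a h p (fun _ => z) q ^ 2 ≤
        p1SiteBare a h (fun y k l => (193 / 125) * ((7 * (5 / 4 : ℝ) + 3 / 4) / 4) * fpChi ((81 / 20 * a) ^ 2) ((27 / 5 * a) ^ 2) (y - fun k => hcpSite a h p k) ^ 2 *
          (fpSq (y - fun k => hcpSite a h p k))⁻¹ ^ 5 * ((y - fun k => hcpSite a h p k) k * (y - fun k => hcpSite a h p k) l)) (fun _ => z) q ∧
      p1SiteBare a h (fun y k l => (193 / 125) * ((3 / 4 : ℝ) / 4) * fpChi ((81 / 20 * a) ^ 2) ((27 / 5 * a) ^ 2) (y - fun k => hcpSite a h p k) ^ 2 *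
          (fpSq (y - fun k => hcpSite a h p k))⁻¹ ^ 4 * (if k = l then 1 else 0)) (fun _ => z) q ≤ (p1LU p q).2 * fpSq z)
    -- (PAY_near) the far table's column sums over the FINITELY MANY sites of the 44a box WITHIN 44a of y_p, by the PINNED payments minus the kernel's far allowance
    (hPAY : ∀ p ∈ ({(0, 0, 0), (1, 0, 0)} : Finset (ℤ × ℤ × ℤ)), ∀ s ∈ p1BondOffsets, (193 / 125) * (2 / 5) / a ^ 4 *
      (∑ q ∈ Finset.Icc (p.1 - 53) (p.1 + 53) ×ˢ (Finset.Icc (p.2.1 - 69) (p.2.1 + 69) ×ˢ Finset.Icc (p.2.2 - 51) (p.2.2 + 51)),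
        if ‖hcpSite a h q - hcpSite a h p‖ < 44 * a then
          p1RecTable a h (p1SplitDensity (81 / 20 * a) (27 / 5 * a)) (decide (Even p.1)) (q - p) s else 0) ≤
      p1Paym p s - 3 / 200000 * p1BondW (fun _ => (1 : ℝ)) p s)
    -- (NC_tiers) THE NEAR CERTIFICATE'S TIERS for SOME stencilled decaying finitely supported near tables, flux enclosure tables and active site sets
    (hNC : ∃ M₁ N : ℝ → ℝ → Bool → (ℤ × ℤ × ℤ) → (ℤ × ℤ × ℤ) → (ℤ × ℤ × ℤ) → ℝ, ∃ QT : (ℤ × ℤ × ℤ) → Finset (ℤ × ℤ × ℤ),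
      ∃ F0 : ℝ → ℝ → (ℤ × ℤ × ℤ) → ((ℤ × ℤ × ℤ) × Fin 3 → (ℤ × ℤ × ℤ) × Fin 3 → ℝ), ∃ Δ : ℝ → ℝ → (ℤ × ℤ × ℤ) → (ℤ × ℤ × ℤ) → ℝ,
      ∃ S : (ℤ × ℤ × ℤ) → Finset (ℤ × ℤ × ℤ),
      (∀ b d s s', s ∉ p1BondOffsets ∨ s' ∉ p1BondOffsets → M₁ a h b d s s' = 0 ∧ N a h b d s s' = 0) ∧
      (∃ C₁ : ℝ, ∀ p q : ℤ × ℤ × ℤ, ∀ s s', |M₁ a h (decide (Even p.1)) (q - p) s s'| ≤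
        C₁ * ((1 + ‖hcpSite a h q - hcpSite a h p‖)⁻¹) ^ 6 ∧
      |N a h (decide (Even p.1)) (q - p) s s'| ≤ C₁ * ((1 + ‖hcpSite a h q - hcpSite a h p‖)⁻¹) ^ 6) ∧
      (∀ p ∈ ({(0, 0, 0), (1, 0, 0)} : Finset (ℤ × ℤ × ℤ)), ∀ q : ℤ × ℤ × ℤ, q ∉ QT p → ∀ s s',
      M₁ a h (decide (Even p.1)) (q - p) s s' = 0 ∧ M₁ a h (decide (Even q.1)) (p - q) s s' = 0 ∧
      N a h (decide (Even p.1)) (q - p) s s' = 0 ∧ N a h (decide (Even q.1)) (p - q) s' s = 0) ∧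
      ∀ p ∈ ({(0, 0, 0), (1, 0, 0)} : Finset (ℤ × ℤ × ℤ)),
        -- (ACT) the active site set contains the base and two sites not collinear with it
        (p ∈ S p ∧ ∃ q₁ ∈ S p, ∃ q₂ ∈ S p, p1Rel a h p q₁ ⨯₃ p1Rel a h p q₂ ≠ 0) ∧
        -- (ENC) block-row bounds of the exact collar flux against the booked tables at (a,h)
        (∃ R : (ℤ × ℤ × ℤ) → (ℤ × ℤ × ℤ) → ℝ, (∀ q q', 0 ≤ R q q') ∧ (∀ q q', R q q' = R q' q) ∧
          (∀ q ∈ p1ScatterQF (p1CollarBox p), ∀ q' ∈ p1ScatterQF (p1CollarBox p),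
            ∑ k, ∑ l, (p1ScatterFL0 (p1ExactFluxMat a h p) (p1CollarBox p) (q, k) (q', l) - F0 a h p (q, k) (q', l)) ^ 2 ≤ R q q' ^ 2) ∧
          (∀ q ∈ p1ScatterQF (p1CollarBox p), ∑ q' ∈ p1ScatterQF (p1CollarBox p), R q q' ≤ Δ a h p q)) ∧
        -- (NC_grid) the 81 node ledgers: X(a_i, h_j; u) ≥ m_min·Σ_{q∈S}‖u_q‖² for every u
        (∀ u : ℤ × ℤ × ℤ → (Fin 3 → ℝ), ∀ i j : ℕ, i ≤ 8 → j ≤ 8 →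
          583 / 134217728 * p1NormSq (S p) u ≤
            p1LedgerX (97119 / 100000 + i * (1 / 40000)) (79284 / 100000 + j * (1 / 40000)) p
              (M₁ (97119 / 100000 + i * (1 / 40000)) (79284 / 100000 + j * (1 / 40000)))
              (N (97119 / 100000 + i * (1 / 40000)) (79284 / 100000 + j * (1 / 40000))) (QT p)
              (F0 (97119 / 100000 + i * (1 / 40000)) (79284 / 100000 + j * (1 / 40000)) p)
              (Δ (97119 / 100000 + i * (1 / 40000)) (79284 / 100000 + j * (1 / 40000)) p) (S p) u) ∧
        -- (NC_box) twice differentiable in a and in h on the box, curvature bounded by B_aa = 10941, B_hh = 3440 times Σ_{q∈S}‖u_q‖²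
        (∀ u : ℤ × ℤ × ℤ → (Fin 3 → ℝ), ∃ Xa Xaa Xh Xhh : ℝ → ℝ → ℝ,
          (∀ a' ∈ Icc (97119 / 100000 : ℝ) (97139 / 100000), ∀ h' ∈ Icc (79284 / 100000 : ℝ) (79304 / 100000),
            HasDerivAt (fun x => p1LedgerX x h' p (M₁ x h') (N x h') (QT p) (F0 x h' p) (Δ x h' p) (S p) u) (Xa a' h') a') ∧
          (∀ a' ∈ Icc (97119 / 100000 : ℝ) (97139 / 100000), ∀ h' ∈ Icc (79284 / 100000 : ℝ) (79304 / 100000),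
            HasDerivAt (fun x => Xa x h') (Xaa a' h') a') ∧
          (∀ a' ∈ Icc (97119 / 100000 : ℝ) (97139 / 100000), ∀ h' ∈ Icc (79284 / 100000 : ℝ) (79304 / 100000),
            Xaa a' h' ≤ 10941 * p1NormSq (S p) u) ∧
          (∀ a' ∈ Icc (97119 / 100000 : ℝ) (97139 / 100000), ∀ h' ∈ Icc (79284 / 100000 : ℝ) (79304 / 100000),
            HasDerivAt (fun y => p1LedgerX a' y p (M₁ a' y) (N a' y) (QT p) (F0 a' y p) (Δ a' y p) (S p) u) (Xh a' h') h') ∧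
          (∀ a' ∈ Icc (97119 / 100000 : ℝ) (97139 / 100000), ∀ h' ∈ Icc (79284 / 100000 : ℝ) (79304 / 100000),
            HasDerivAt (fun y => Xh a' y) (Xhh a' h') h') ∧
          (∀ a' ∈ Icc (97119 / 100000 : ℝ) (97139 / 100000), ∀ h' ∈ Icc (79284 / 100000 : ℝ) (79304 / 100000),
            Xhh a' h' ≤ 3440 * p1NormSq (S p) u))) :
    CoreJointCoercive a h (1 / 3) (1 / 12) := by
  refine coreJointCoercive_cell_of_certificates₁₅ ha hh hfam hB hS hTab hPAY ?_
  obtain ⟨M₁, N, QT, F0, Δ, S, hst, hdec, hQT, hmain⟩ := hNC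
  refine ⟨M₁ a h, N a h, QT, hst, hdec, hQT, fun p hp V hVp hmom => ?_⟩
  obtain ⟨⟨hpS, q₁, hq₁, q₂, hq₂, hx⟩, ⟨R, hR0, hRs, hE, hrow⟩, hgrid, hbox⟩ := hmain p hp
  -- (i) grid + box ⇒ the ledger family is coercive at (a,h): X(a,h;u) ≥ m_box·Σ‖u_q‖²
  have hcoer : ∀ u : ℤ × ℤ × ℤ → (Fin 3 → ℝ),
      168829799 / 52428800000000 * p1NormSq (S p) u ≤ p1LedgerX a h p (M₁ a h) (N a h) (QT p) (F0 a h p) (Δ a h p) (S p) u := by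
    intro u
    obtain ⟨Xa, Xaa, Xh, Xhh, dFa, dFaa, bFaa, dFh, dFhh, bFhh⟩ := hbox u
    exact near_gridBox_lower_v10
      (F := fun x y => p1LedgerX x y p (M₁ x y) (N x y) (QT p) (F0 x y p) (Δ x y p) (S p) u)
      (Fa := Xa) (Faa := Xaa) (Fh := Xh) (Fhh := Xhh) (p1NormSq_nonneg _ u) (hgrid u) dFa dFaa bFaa dFh dFhh bFhh ha hh hfam
  -- (ii) deflation removal + gauge reduction ⇒ the BOOKED near form is ≥ 0 at V
  have hbooked : 0 ≤ p1NearForm a h (1 / 3) (1 / 12) (193 / 125) p p1Stencil (p1Beta a h) (M₁ a h) (N a h) (p1FarW a h (p1Phi0 p) p) p1SV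
      (p1FarWv a h (p1Phi0 p) p) (fun s => -p1Beta a h (decide (Even p.1)) 0 s) (p1StarAt p) (p1QB p) (QT p)
      (p1ScatterQF (p1CollarBox p)) (p1FarLegs (p1Phi0 p) p) (fun q => (p1LU p q).1 / ‖hcpSite a h q - hcpSite a h p‖ ^ 2)
      (fun q => (p1LU p q).2) (p1Paym p) (Δ a h p) (F0 a h p) V :=
    nearForm_nonneg_of_ledger_coercive' ha p (S p) hpS hq₁ hq₂ hx
      (fun W => p1NearForm a h (1 / 3) (1 / 12) (193 / 125) p p1Stencil (p1Beta a h) (M₁ a h) (N a h) (p1FarW a h (p1Phi0 p) p) p1SV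
        (p1FarWv a h (p1Phi0 p) p) (fun s => -p1Beta a h (decide (Even p.1)) 0 s) (p1StarAt p) (p1QB p) (QT p)
        (p1ScatterQF (p1CollarBox p)) (p1FarLegs (p1Phi0 p) p) (fun q => (p1LU p q).1 / ‖hcpSite a h q - hcpSite a h p‖ ^ 2)
        (fun q => (p1LU p q).2) (p1Paym p) (Δ a h p) (F0 a h p) W)
      (by norm_num) (fun u => hcoer u) hVp hmom
  -- (iii) flux booking: exact collar flux ≤ enclosure form
  have hENC := p1ExactFluxSum_le_p1NearFlux_of_blockRows a h p (F0 a h p) (Δ a h p) R hR0 hRs hE hrow V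
  -- (iv) assemble
  rw [p1NearForm_booked_eq] at hbooked
  have hκ : (0 : ℝ) ≤ 193 / 125 := by norm_num
  have := mul_le_mul_of_nonneg_left hENC hκ
  show 0 ≤ _
  unfold p1StarAt at hbooked
  linarith

end Summit.AtomisticToContinuum.Crystallization.Theorems.StrictSplittingRuleBirth

end
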